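import Summits.QuantumFields.YangMills.Theorems.FluctuationComparisonRegPrIntLS2BetaRelativeTowerSupBudgetStart
import HarnessLib

/-!
# S2β · the (D♮)∕(D-stage) REL-TEL road — THE SUP BUDGET OF A STAGE TOWER OVER A DATUM IN THE EXPLICIT SMALL-BOND GUARD `arc(V e) ≤ 1∕128`:
# every gauged level has arcs `≤ 1∕4`, `Σ_{t<K−J} s_{t+1} ≤ E(L)` and `Σ_{t<K−J} s_{t+1}² ≤ E(L)` — DEPTH- and VOLUME-FREE, guard constant INDEPENDENT of `L, b₀, p₀`

Cell `ym3-torus` (rung R3 = continuum `SU(2)` Yang–Mills on T³ — NOT d = 4, NOT infinite volume, NOT a mass gap, NOT Clay).  Width seat «width 12» `ym3-torus-px12`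
(gen 24), FREE px helper on crux `stmt-QuantumFields-20520`; `--kind proof --supports … --as helper`, count-neutral, DEFINITION-FREE (0 `def`∕`instance`∕`notation`∕`sorry`).

WHY.  ✓p823294∕✓p826174 `exists_gamma_supBudget_start(_l1)` export the guard ceiling as `∃ M, 0 < M ∧ M ≤ 1∕4` chosen AFTER `(L, b₀, p₀)`; a stratum GUARD
`G′ F J V` (✓p824968, ✓p823271, ✓p824471's prefix) is a FIXED predicate of `(F, J, V)` and cannot mention such an `M`.  Here the guard is the EXPLICIT constant
`1∕128` (`≤ M(L) = min(1∕4, (1−L⁻¹)∕(2(C₂(L)+1)))`, `C₂(L) = 12π·NP∕L² ≤ 12π` since `NP = 2⌊(L−1)∕2⌋(L+1) ≤ L²`, `L ≥ 2`, `π < 3.15`), the profile ceiling is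
exported as `1∕4`, and the two sums (ℓ¹ and ℓ²) share one budget `E = 3E₀∕M`.  Consumers: the (L♭) chart letter in the explicit guard (⧗`exists_gamma_chartLetter_128`),
(F3)-rel's `s, s̃ ≤ 1∕4` (✓p826241), the (H♭♭) FEEDERS door's `Σφ` budget (✓p826444), the (D-stage) assembly's guard `G′ := G ∧ «arc ≤ 1∕128»`.
Proof = ✓`exists_gamma_supBudget_start_l1` verbatim with the bound `1∕128 ≤ M` inserted (same constants; [Balaban1985RegularSpaces] Lemma 1 p.79 locus only).
‼ The small-bond guard itself is NOT suppliable as a `∀ F ∀ J` Prop on the strata at coarse `J` (toron∕Polyakov obstruction, UV3-NODE §84.8∕§86.5, px8 g24's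
⧗`…SmallBondGaugeToronObstruction`); this file is a LETTER under the guard, not a supplier.
HONEST SCOPE.  Nothing of Bałaban's analysis is asserted; (L♭), (H♭♭), (D-ax)∕(D♮), GAP♯∘ (`stub_uniformFibreGapOrbit`), S2β, the five registered stubs (0∕5), crux 20520 and
`YM3TorusSU2` are NOT proved; no registered stub is closed; the Yang–Mills mass gap is NOT proved.
-/

set_option autoImplicit false

noncomputable section

namespace Summit.QuantumFields.YangMills.Theorems.FluctuationComparisonRegPrIntLS2BetaRelativeTowerSupBudget128

open Finset
open scoped Real
open Literature.MathematicalPhysics.QuantumLattice (su2Quat)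
open Literature.MathematicalPhysics.QuantumFieldTheory.Balaban1983to89
open T4Continuum T3ContinuumYM3Torus T3UnitScaleTilt T3TiltDescent T3LevelShift BlockAveraging
open T4CubeChartGnomonic (SU2)
open T4HaarSU2ExpChart (expPoint)
open T4ExpWindowSmallField (logVec)
open T3UnitLawDensityEML (ℰp)
open T3ConstrainedMinimiser (fibre)
open B10Eq27TorusAxialLog (rel axialT)
open Summit.QuantumFields.YangMills.Theorems.FluctuationComparisonRegPrIntLS2BetaRelativeTowerSupProfileStart (exists_supProfile_relativeTower_start)
open Summit.QuantumFields.YangMills.Theorems.FluctuationComparisonRegPrIntLS2BetaContractingSupStart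
  (sq_budget_of_start linearised_of_bootstrap_start sum_succ_le_of_contract_start)
open Summit.QuantumFields.YangMills.Theorems.FluctuationComparisonRegPrIntLS2BetaRelativeTowerSupBudgetStart (norm_logVec_iter_le_of_mem_fibre)
open Summit.QuantumFields.YangMills.Theorems.FluctuationComparisonRegPrIntLS2BetaThresholdSum (thresholdSum_small)

/-- **THE EXPLICIT GUARD FITS UNDER THE CEILING**: `1∕128 ≤ M(L) = min(1∕4, (1 − L⁻¹)∕(2(C₂(L) + 1)))`, `C₂(L) = (π∕2)·NP·24·L⁻²`,
`NP = 2⌊(L−1)∕2⌋(L+1) ≤ L² − 1`, for every `L ≥ 2` (`π < 3.15`). [cite: Balaban1985RegularSpaces, Lemma 1 p.79] -/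
theorem one_div_128_le_ceiling (L : ℕ) (hL : 1 < L) :
    (1 : ℝ) / 128 ≤ min (1 / 4) ((1 - (L : ℝ)⁻¹) / (2 * (π / 2 * ((((3 - 1) * ((L - 1) / 2) * (L + 1) : ℕ) : ℝ)) * 24 * ((L : ℝ)⁻¹) ^ 2 + 1))) := by
  have hL' : (1 : ℝ) < L := by exact_mod_cast hL
  have hL0 : (0 : ℝ) < L := by linarith
  set NP : ℝ := ((((3 - 1) * ((L - 1) / 2) * (L + 1) : ℕ) : ℝ)) with hNP
  set r₀ : ℝ := (L : ℝ)⁻¹ with hr₀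
  have hNP0 : 0 ≤ NP := by rw [hNP]; positivity
  have hr00 : 0 ≤ r₀ := by rw [hr₀]; positivity
  refine le_min (by norm_num) ?_
  have hNPr : NP ≤ (L : ℝ) ^ 2 - 1 := by
    have hk : (((L - 1) / 2 : ℕ) : ℝ) ≤ ((L : ℝ) - 1) / 2 := by
      have h := Nat.cast_div_le (m := L - 1) (n := 2) (α := ℝ)
      rw [Nat.cast_sub hL.le] at h
      simpa using h
    have hk0 : (0 : ℝ) ≤ (((L - 1) / 2 : ℕ) : ℝ) := Nat.cast_nonneg _
    rw [hNP]; push_cast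
    nlinarith [hk, hk0, hL0]
  have hNPle : NP * ((L : ℝ)⁻¹) ^ 2 ≤ 1 - r₀ ^ 2 := by
    have hL2 : (0 : ℝ) < (L : ℝ) ^ 2 := by positivity
    rw [hr₀, inv_pow, ← div_eq_mul_inv, div_le_iff₀ hL2, sub_mul, one_mul, inv_mul_cancel₀ hL2.ne']
    exact hNPr
  have hC₂le : π / 2 * NP * 24 * ((L : ℝ)⁻¹) ^ 2 ≤ 12 * π * (1 - r₀ ^ 2) := by
    have : π / 2 * NP * 24 * ((L : ℝ)⁻¹) ^ 2 = 12 * π * (NP * ((L : ℝ)⁻¹) ^ 2) := by ring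
    rw [this]
    exact mul_le_mul_of_nonneg_left hNPle (by positivity)
  have hr₀le : r₀ ≤ 1 / 2 := by
    rw [hr₀]
    have hL2 : (2 : ℝ) ≤ L := by exact_mod_cast hL
    rw [inv_eq_one_div, div_le_div_iff₀ hL0 (by norm_num)]
    linarith
  have hπ := Real.pi_lt_d2
  have hπ0 := Real.pi_pos
  have hC0 : 0 ≤ π / 2 * NP * 24 * ((L : ℝ)⁻¹) ^ 2 := by positivity
  rw [div_le_div_iff₀ (by norm_num) (by positivity)]
  have hu : 0 ≤ 1 / 2 - r₀ := by linarith
  nlinarith [mul_nonneg hu hr00, mul_nonneg hu hπ0.le, mul_nonneg (mul_nonneg hu hr00) hπ0.le, mul_nonneg hr00 hπ0.le,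
    mul_nonneg (mul_nonneg hr00 hr00) hπ0.le]
set_option maxHeartbeats 400000 in
/-- ★★★ **THE SUP BUDGET IN THE EXPLICIT GUARD `1∕128`**: for `γ ≤ γ₁(L, b₀, p₀)`, a datum with `arc(V e) ≤ 1∕128` at every bond, a good history
`U ∈ fibre(V)` and its stage tower (hat lift, (T1), (T4), (T5)), there is a sup profile `s ≥ 0` of the gauged levels with every level `≤ 1∕4`,
`Σ_{t<K−J} s(t+1) ≤ E` and `Σ_{t<K−J} s(t+1)² ≤ E`, `E = E(L, b₀, p₀)` depth- and volume-free. [cite: Balaban1985RegularSpaces, Lemma 1 p.79, (1.29) p.81] -/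
theorem exists_gamma_supBudget_128 (L : ℕ) (hL : 1 < L) (b₀ p₀ : ℝ) (hb : 0 < b₀) (hp : 0 < p₀) :
    ∃ E : ℝ, 0 ≤ E ∧ ∃ γ₁ : ℝ, 0 < γ₁ ∧ ∀ (F : T3Family) (γ : ℝ), F.L = L → 0 < γ → γ ≤ γ₁ →
      ∀ (J K : ℕ) (hJK : J ≤ K) (Vd : GaugeField (F.P J) 0 SU2), (∀ e, ‖logVec (su2Quat (Vd e))‖ ≤ 1 / 128) →
      ∀ (U : GaugeField (F.P K) 0 SU2), U ∈ fibre F ℰp J K hJK Vd → U ∈ histGood F ℰp (θBal F.L γ b₀ p₀) K J →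
      ∀ (g : (j : ℕ) → Site (F.P K) j → SU2) (w : (t : ℕ) → PBond (F.P K) t → PBond (F.P K) (t + 1) → ℝ)
        (V : (t : ℕ) → GaugeField (F.P K) t SU2),
        (∀ t, t < K - J → ∀ b e, w t b e = if e.dir = b.dir ∧ (b.src b.dir - emb e.src b.dir).val < (F.P K).L then
          ∏ ν ∈ Finset.univ.erase b.dir, max 0 (1 - ((rel (emb e.src) b.src ν).natAbs : ℝ) / (F.P K).L) else 0) →
        (∀ t, t < K - J → ∀ b, V t b = expPoint (∑ e, w t b e • ((((F.P K).L : ℕ) : ℝ)⁻¹ •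
          logVec (su2Quat (GaugeField.gaugeAct (g (t + 1)) (Averaging.iter (fun k => blockAvg (P := F.P K) (j := k) ℰp) (t + 1) U) e))))) →
        (∀ j, K - J ≤ j → ∀ y, g j y = 1) →
        (∀ t, t < K - J → ∀ z : Site (F.P K) t,
          axialT (GaugeField.gaugeAct (g t) (Averaging.iter (fun k => blockAvg (P := F.P K) (j := k) ℰp) t U)) (emb (blockOf z)) z =
            axialT (V t) (emb (blockOf z)) z) →
        (∀ t, t < K - J → avgFun ℰp (GaugeField.gaugeAct (g t) (Averaging.iter (fun k => blockAvg (P := F.P K) (j := k) ℰp) t U)) =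
          GaugeField.gaugeAct (g (t + 1)) (Averaging.iter (fun k => blockAvg (P := F.P K) (j := k) ℰp) (t + 1) U)) →
        ∃ s : ℕ → ℝ, (∀ t, 0 ≤ s t) ∧
          (∀ t, t ≤ K - J → ∀ b, ‖logVec (su2Quat (GaugeField.gaugeAct (g t) (Averaging.iter (fun k => blockAvg (P := F.P K) (j := k) ℰp) t U) b))‖ ≤ s t) ∧
          (∀ t, t ≤ K - J → s t ≤ 1 / 4) ∧ ∑ t ∈ range (K - J), s (t + 1) ≤ E ∧ ∑ t ∈ range (K - J), s (t + 1) ^ 2 ≤ E := by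
  -- the constants of the one-level step at `d = 3`, block size `L` (px17's)
  have hL' : (1 : ℝ) < L := by exact_mod_cast hL
  have hL0 : (0 : ℝ) < L := by linarith
  obtain ⟨NP, hNP⟩ : ∃ x : ℝ, x = (((3 - 1) * ((L - 1) / 2) * (L + 1) : ℕ) : ℝ) := ⟨_, rfl⟩
  obtain ⟨G, hG⟩ : ∃ x : ℝ, x = ((((3 + 2) * L : ℕ) : ℝ) ^ 2 / 4) := ⟨_, rfl⟩
  have hNP0 : 0 ≤ NP := by rw [hNP]; positivity
  have hG0 : 0 < G := by rw [hG]; positivity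
  obtain ⟨A₁, hA₁⟩ : ∃ x : ℝ, x = π / 2 * (NP + 2 * G) := ⟨_, rfl⟩
  obtain ⟨A₂, hA₂⟩ : ∃ x : ℝ, x = π / 2 * (NP * ((L : ℝ)⁻¹) ^ 2 * (π / 2)) := ⟨_, rfl⟩
  obtain ⟨C₂, hC₂⟩ : ∃ x : ℝ, x = π / 2 * NP * 24 * ((L : ℝ)⁻¹) ^ 2 := ⟨_, rfl⟩
  obtain ⟨r₀, hr₀⟩ : ∃ x : ℝ, x = (L : ℝ)⁻¹ := ⟨_, rfl⟩
  have hA₁0 : 0 ≤ A₁ := by rw [hA₁]; positivity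
  have hA₂0 : 0 ≤ A₂ := by rw [hA₂]; positivity
  have hC₂0 : 0 ≤ C₂ := by rw [hC₂]; positivity
  have hr00 : 0 ≤ r₀ := by rw [hr₀]; positivity
  have hr01 : r₀ < 1 := by rw [hr₀]; exact inv_lt_one_of_one_lt₀ hL'
  have h1r : 0 < 1 - r₀ := by linarith
  -- the ceiling `M` and the threshold budget `Smax`
  obtain ⟨M, hM⟩ : ∃ x : ℝ, x = min (1 / 4) ((1 - r₀) / (2 * (C₂ + 1))) := ⟨_, rfl⟩
  have hM0 : 0 < M := by rw [hM]; exact lt_min (by norm_num) (by positivity)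
  have hM4 : M ≤ 1 / 4 := by rw [hM]; exact min_le_left _ _
  have hMC : C₂ * M ≤ (1 - r₀) / 2 := by
    have h1 : M ≤ (1 - r₀) / (2 * (C₂ + 1)) := by rw [hM]; exact min_le_right _ _
    calc C₂ * M ≤ (C₂ + 1) * ((1 - r₀) / (2 * (C₂ + 1))) := by nlinarith
      _ = (1 - r₀) / 2 := by field_simp
  obtain ⟨Smax, hSmax⟩ : ∃ x : ℝ, x = (1 - r₀) / 2 * M := ⟨_, rfl⟩
  have hSmax0 : 0 < Smax := by rw [hSmax]; positivity
  -- the linearised ratio and the budget `E`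
  obtain ⟨q, hq⟩ : ∃ x : ℝ, x = r₀ + C₂ * M := ⟨_, rfl⟩
  have hq0 : 0 ≤ q := by rw [hq]; positivity
  have hq1 : q < 1 := by rw [hq]; linarith
  obtain ⟨E, hE⟩ : ∃ x : ℝ, x = M * ((q * M + Smax) / (1 - q) + M) / 3 := ⟨_, rfl⟩
  have hE0 : 0 ≤ E := by
    rw [hE]
    have : 0 ≤ (q * M + Smax) / (1 - q) := div_nonneg (by positivity) (by linarith)
    positivity
  -- the size guard for a single threshold: the `ℰp` guards (px17's `a₀`)
  have hδSU := ExpMeanLog.deltaSU_pos (n := Fin 2)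
  obtain ⟨a₀, ha₀⟩ : ∃ x : ℝ, x = min (min (ExpMeanLog.deltaSU (Fin 2) / (2 * G)) (1 / (6 * G))) (Smax / (2 * (A₂ + 1))) := ⟨_, rfl⟩
  have ha₀0 : 0 < a₀ := by rw [ha₀]; exact lt_min (lt_min (by positivity) (by positivity)) (by positivity)
  obtain ⟨γ₁, hγ₁, hth⟩ := thresholdSum_small L hL b₀ p₀ hb hp (A₁ + A₂) a₀ (Smax / 2) (by positivity) ha₀0 (by positivity)
  -- the explicit guard: `1∕128 ≤ M(L)` for every `L ≥ 2` (`NP ≤ L² − 1`, `π < 3.15`)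
  have h128 : (1 : ℝ) / 128 ≤ M := by rw [hM, hC₂, hr₀, hNP]; exact one_div_128_le_ceiling L hL
  have hEM0 : 0 ≤ 3 * E / M := by positivity
  refine ⟨3 * E / M, hEM0, γ₁, hγ₁, fun F γ hFL hγ hγ1 J K hJK Vd hVσ' U hUf hUg g w V hw hV hT1 hax hT5 => ?_⟩
  have hVσ : ∀ e, ‖logVec (su2Quat (Vd e))‖ ≤ M := fun e => (hVσ' e).trans h128
  obtain ⟨hθa, hsum⟩ := hth γ hγ hγ1
  have hPd : (F.P K).d = 3 := rfl
  have hPL : (F.P K).L = L := hFL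
  rw [hFL] at hUg
  have hm : K - J ≤ (F.P K).m + (F.P K).K := by show K - J ≤ F.m + K; omega
  -- thresholds on the gauged levels (gauge invariance of plaquette sizes)
  set θ : ℕ → ℝ := fun t => θBal L γ b₀ p₀ (K - t) with hθ
  have hθ0 : ∀ t, 0 ≤ θ t := fun t => (hθa _).1
  have hθa' : ∀ t, θ t ≤ a₀ := fun t => (hθa _).2
  have hθU : ∀ t, t ≤ K - J → PlaqSmall (θ t) (GaugeField.gaugeAct (g t) (Averaging.iter (fun k => blockAvg (P := F.P K) (j := k) ℰp) t U)) := by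
    intro t ht p
    rw [T4ReTrLipUnitary.plaqHol_gaugeAct, GaugeGroup.dist1_conj]
    exact hUg t (by omega) p
  -- the guards from `θ ≤ a₀`
  have hGa : G * a₀ < ExpMeanLog.deltaSU (Fin 2) ∧ G * a₀ ≤ 1 / 6 := by
    have h1 : a₀ ≤ ExpMeanLog.deltaSU (Fin 2) / (2 * G) := by rw [ha₀]; exact (min_le_left _ _).trans (min_le_left _ _)
    have h2 : a₀ ≤ 1 / (6 * G) := by rw [ha₀]; exact (min_le_left _ _).trans (min_le_right _ _)
    constructor
    · calc G * a₀ ≤ G * (ExpMeanLog.deltaSU (Fin 2) / (2 * G)) := mul_le_mul_of_nonneg_left h1 hG0.le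
        _ = ExpMeanLog.deltaSU (Fin 2) / 2 := by field_simp
        _ < ExpMeanLog.deltaSU (Fin 2) := by linarith
    · calc G * a₀ ≤ G * (1 / (6 * G)) := mul_le_mul_of_nonneg_left h2 hG0.le
        _ = 1 / 6 := by field_simp
  have hg1 : ∀ t, t < K - J → (((((F.P K).d + 2) * (F.P K).L : ℕ) : ℝ) ^ 2 / 4) * θ t < ExpMeanLog.deltaSU (Fin 2) := by
    intro t _; rw [hPd, hPL, ← hG]
    exact lt_of_le_of_lt (mul_le_mul_of_nonneg_left (hθa' t) hG0.le) hGa.1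
  have hg2 : ∀ t, t < K - J → (((((F.P K).d + 2) * (F.P K).L : ℕ) : ℝ) ^ 2 / 4) * θ t ≤ 1 / 6 := by
    intro t _; rw [hPd, hPL, ← hG]
    exact le_trans (mul_le_mul_of_nonneg_left (hθa' t) hG0.le) hGa.2
  -- the general-top profile and its conditional quadratic step
  obtain ⟨s, hsm, hs0, hsb, hstep⟩ := exists_supProfile_relativeTower_start hm
    (fun t => GaugeField.gaugeAct (g t) (Averaging.iter (fun k => blockAvg (P := F.P K) (j := k) ℰp) t U)) w V hw hV hax hT5 θ hθ0 hθU hg1 hg2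
  -- the START: the top of the tower is the datum (trivial top gauge), bond by bond
  have hstart : s (K - J) ≤ M := by
    refine hsm M fun b => ?_
    have hg0 : g (K - J) = fun _ => 1 := funext (hT1 (K - J) le_rfl)
    simp only [hg0, T4AxialGaugeFixing.gaugeAct_const_one]
    exact norm_logVec_iter_le_of_mem_fibre F hJK hUf hVσ b
  -- the step in the bootstrap's currency
  set ρ : ℕ → ℝ := fun t => A₁ * θ t + A₂ * θ (t + 1) with hρ
  have hρ0 : ∀ t, 0 ≤ ρ t := fun t => add_nonneg (mul_nonneg hA₁0 (hθ0 t)) (mul_nonneg hA₂0 (hθ0 _))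
  have hstep' : ∀ t, t < K - J → s (t + 1) ≤ 1 / 4 → s t ≤ r₀ * s (t + 1) + ρ t + C₂ * s (t + 1) ^ 2 := by
    intro t ht h4
    have h := hstep t ht h4
    rw [hPd, hPL] at h
    refine h.trans (le_of_eq ?_)
    simp only [hρ, hA₁, hA₂, hC₂, hr₀, hNP, hG]
    ring
  -- the threshold sum: `Σ_{t<m} ρ t ≤ (A₁ + A₂)·Σθ + A₂·a₀ ≤ Smax` (px17's count verbatim)
  have hSρ : ∑ t ∈ range (K - J), ρ t ≤ Smax := by
    have hs1 : ∑ t ∈ range (K - J), ρ t =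
        A₁ * ∑ t ∈ range (K - J), θ t + A₂ * ∑ t ∈ range (K - J), θ (t + 1) := by
      simp only [hρ, sum_add_distrib, mul_sum]
    have hshift : ∑ t ∈ range (K - J), θ (t + 1) ≤ ∑ t ∈ range (K - J), θ t + a₀ := by
      rcases Nat.eq_zero_or_pos (K - J) with h0 | hpos
      · rw [h0]; simp [ha₀0.le]
      · obtain ⟨m, hm'⟩ : ∃ m, K - J = m + 1 := ⟨K - J - 1, by omega⟩
        rw [hm', Finset.sum_range_succ' θ, Finset.sum_range_succ (fun t => θ (t + 1))]
        have := hθ0 0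
        have := hθa' (m + 1)
        linarith
    have hmain := hsum J K hJK
    have hθsum0 : 0 ≤ ∑ t ∈ range (K - J), θ t := sum_nonneg fun t _ => hθ0 t
    have ha₀S : A₂ * a₀ ≤ Smax / 2 := by
      have h3 : a₀ ≤ Smax / (2 * (A₂ + 1)) := by rw [ha₀]; exact min_le_right _ _
      calc A₂ * a₀ ≤ A₂ * (Smax / (2 * (A₂ + 1))) := mul_le_mul_of_nonneg_left h3 hA₂0
        _ ≤ (A₂ + 1) * (Smax / (2 * (A₂ + 1))) := mul_le_mul_of_nonneg_right (by linarith) (by positivity)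
        _ = Smax / 2 := by field_simp
    rw [hs1]
    have hA₂sh := mul_le_mul_of_nonneg_left hshift hA₂0
    calc A₁ * ∑ t ∈ range (K - J), θ t + A₂ * ∑ t ∈ range (K - J), θ (t + 1)
        ≤ A₁ * ∑ t ∈ range (K - J), θ t + A₂ * (∑ t ∈ range (K - J), θ t + a₀) := by linarith
      _ = (A₁ + A₂) * ∑ i ∈ range (K - J), θBal L γ b₀ p₀ (K - i) + A₂ * a₀ := by simp only [hθ]; ring
      _ ≤ Smax / 2 + Smax / 2 := add_le_add hmain ha₀S
      _ = Smax := by ring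
  -- the bootstrap from the start (✓`sq_budget_of_start`)
  have hsmall₁ : Smax ≤ (1 - r₀) / 2 * M := by rw [hSmax]
  obtain ⟨hall, hsq⟩ := sq_budget_of_start s ρ (K - J) r₀ C₂ (1 / 4) M Smax hstart hs0 hρ0 hSρ hstep' hr00 hr01 hC₂0 hM4 hsmall₁ hMC
  obtain ⟨hq0', hq1', hlin⟩ :=
    linearised_of_bootstrap_start s ρ (K - J) r₀ C₂ (1 / 4) M Smax hstart hs0 hρ0 hSρ hstep' hr00 hr01 hC₂0 hM4 hsmall₁ hMC
  have hl1 := sum_succ_le_of_contract_start _ hq0' hq1' s ρ (K - J) hs0 hlin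
  -- `(q·s_top + Σρ)∕(1 − q) + s_top ≤ (q·M + Smax)∕(1 − q) + M = 3E∕M`
  rw [← hq] at hsq hl1
  have h1q : 0 < 1 - q := by linarith
  have hnum : q * s (K - J) + ∑ t ∈ range (K - J), ρ t ≤ q * M + Smax := add_le_add (mul_le_mul_of_nonneg_left hstart hq0) hSρ
  have hdiv : (q * s (K - J) + ∑ t ∈ range (K - J), ρ t) / (1 - q) ≤ (q * M + Smax) / (1 - q) := div_le_div_of_nonneg_right hnum h1q.le
  have hbound : (q * s (K - J) + ∑ t ∈ range (K - J), ρ t) / (1 - q) + s (K - J) ≤ 3 * E / M := by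
    rw [le_div_iff₀ hM0, hE]
    calc ((q * s (K - J) + ∑ t ∈ range (K - J), ρ t) / (1 - q) + s (K - J)) * M
        ≤ ((q * M + Smax) / (1 - q) + M) * M := mul_le_mul_of_nonneg_right (add_le_add hdiv hstart) hM0.le
      _ = 3 * (M * ((q * M + Smax) / (1 - q) + M) / 3) := by ring
  have hM1 : M ≤ 1 := hM4.trans (by norm_num)
  have h3E : 3 * E ≤ 3 * E / M := by
    rw [le_div_iff₀ hM0]
    nlinarith [hE0]
  refine ⟨s, hs0, hsb, fun t ht => (hall t ht).trans hM4, hl1.trans hbound, (hsq.trans ?_).trans h3E⟩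
  calc M * ((q * s (K - J) + ∑ t ∈ range (K - J), ρ t) / (1 - q) + s (K - J))
      ≤ M * (3 * E / M) := mul_le_mul_of_nonneg_left hbound hM0.le
    _ = 3 * E := by field_simp

end Summit.QuantumFields.YangMills.Theorems.FluctuationComparisonRegPrIntLS2BetaRelativeTowerSupBudget128

end
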